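import Mathlib
import Literature.Analysis.ValidatedNumerics.TaylorModelIntegralCertTrig
import Literature.Analysis.ValidatedNumerics.TaylorModelExpr
import Literature.MathematicalPhysics.MHD.CerfonFreidbergSolutions
import Summits.Ventures.FusionMHD.Models.CerfonFreidbergIterLikeQ90Defs
import Summits.Ventures.FusionMHD.Models.CerfonFreidbergIterLikeQHalfSound
import HarnessLib

/-!
# Ventures/FusionMHD — Models/CerfonFreidbergIterLikeQ90Sound.lean: SOUNDNESS of the per-panel kernel obligation of the
# certified safety factor `q(ψ_N = 9/10)/F` of THE Cerfon–Freidberg ITER-like instance — what `CFIterLike.Q90.PanelCert.ok = true` MEANS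
# (`ψ_N = 9/10` SIBLING of `Models/CerfonFreidbergIterLikeQHalfSound.lean`, ★ #117)

HONEST FRAMING (LADDER-GRIDFUSION three columns; CF rung, F2 item R2; `pub/gridfusion/models/F2-SCOPING.md` v1.5 §9(d): q-profile sample on
the ITER-like rung).  The panel files `…IterLikeQ90Panels1…9.lean` decide `CFIterLike.Q90.PanelCert.ok` for all 32 panels of `t ∈ [0, 1]`
(`θ = π t`).  This file turns each accepted panel into REAL-NUMBER STATEMENTS about THE ITER-like instance `U = cfSolution 0 coeff`.  Everything
not specific to the level is the `ψ_N = 1/2` file's BY NAME (`CFIterLike.QHalf.runF_append`, `getReg_runF_add`, `UXc`, `UYc`, `Drc`, `params`,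
`boxMem_params` — SAME parameter vector and box —, `tmS`/`hw`/`ctr`, `panelCheckT_of_parts`).  New here:
* §1 **`blockG_regs`** — symbolic execution of the `ψ_N = 9/10` evaluation block (residual `U(ray f₀) − U_a/10`, `Drc`, `X·Drc`, top
  `f₀·(X·Drc)⁻¹·p`);
* §2 the APPROXIMANT `mA := progA.toFunP params` of the `ψ_N = 9/10` ray radius and **`progG_regs`**;
* §3 **`sound_of_ok`**: integral segment `FSegOK`, residual `|U(ray mA) − U(X_a,0)/10| ≤ eta/2⁶⁰`, `mA ∈ [mlo, mhi]/2⁶⁰`, `D_r(θ, mA) ∈ [dlo, dhi]/2⁶⁰`.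
MODELLED: analytic Cerfon–Freidberg family, ITER-like triple `(8/25, 17/10, 33/100)`; `q` of a MODEL surface — nothing about a device or
stability.  No `decide` beyond `rfl`-sized facts; axioms standard.  Typer/prover: gridfusion-model-5 (g8), 2026-08-27.
Citations: Freidberg 2014 §6.3.5 (6.35), §6.6.1 (6.153) [Freidberg2014]; Melquiond 2008 §3.3 [Melquiond2008]; Mahboubi–Melquiond–Sibut-Pinote
2016 §3.2 Lemma 3, §4.1 [MahboubiMelquiondSibutpinote2016]; Joldes 2011 Alg. 2.2.10 [Joldes2011].
-/

noncomputable section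

open Set
open Literature.Analysis.ValidatedNumerics Literature.Analysis.ValidatedNumerics.PolyMP
open Literature.Analysis.ValidatedNumerics.NumericsMP Literature.Analysis.ValidatedNumerics.ExpPoly
open Literature.Analysis.ODE
open Literature.MathematicalPhysics.MHD Literature.MathematicalPhysics.MHD.CerfonFreidberg

set_option autoImplicit false

namespace Summit.Ventures.FusionMHD.Models.CFIterLike.Q90

set_option maxRecDepth 100000

/-! ## §1 Symbolic execution of the `ψ_N = 9/10` evaluation block -/

/-- **SYMBOLIC EXECUTION OF `Q90.blockG`** (the `ψ_N = 1/2` block with level constant `−1/10`).  For any stack `stk` with top register `f₀` and the ten constants `c₀…c₆, X_a, U_a, p` at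
depths `296…305`: register 110 of `blockG`'s run is the flux residual `U(X_a + f₀ cos pt, f₀ sin pt) − U_a/10`, register 4 is
`CFIterLike.QHalf.Drc c X_a (f₀ t) (p t)`, register 3 is `X · (register 4)` and the top register is `f₀ · (register 3)⁻¹ · p`. -/
theorem blockG_regs (stk : List (ℝ → ℝ)) (c : Fin 7 → ℝ) (Xa Ua p : ℝ) (f0 : ℝ → ℝ)
    (h0 : getReg (fun _ => (0 : ℝ)) stk 0 = f0)
    (hc0 : getReg (fun _ => (0 : ℝ)) stk 296 = fun _ => c 0)
    (hc1 : getReg (fun _ => (0 : ℝ)) stk 297 = fun _ => c 1)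
    (hc2 : getReg (fun _ => (0 : ℝ)) stk 298 = fun _ => c 2)
    (hc3 : getReg (fun _ => (0 : ℝ)) stk 299 = fun _ => c 3)
    (hc4 : getReg (fun _ => (0 : ℝ)) stk 300 = fun _ => c 4)
    (hc5 : getReg (fun _ => (0 : ℝ)) stk 301 = fun _ => c 5)
    (hc6 : getReg (fun _ => (0 : ℝ)) stk 302 = fun _ => c 6)
    (hXa : getReg (fun _ => (0 : ℝ)) stk 303 = fun _ => Xa)
    (hUa : getReg (fun _ => (0 : ℝ)) stk 304 = fun _ => Ua)
    (hp : getReg (fun _ => (0 : ℝ)) stk 305 = fun _ => p)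
    (t : ℝ) :
    getReg (fun _ => (0 : ℝ)) (TProg.runF CFIterLike.Q90.blockG stk) 110 t
        = cfSolution 0 c (Xa + f0 t * Real.cos (p * t)) (f0 t * Real.sin (p * t)) - 1 / 10 * Ua
    ∧ getReg (fun _ => (0 : ℝ)) (TProg.runF blockG stk) 4 t = CFIterLike.QHalf.Drc c Xa (f0 t) (p * t)
    ∧ getReg (fun _ => (0 : ℝ)) (TProg.runF blockG stk) 3 t
        = (Xa + f0 t * Real.cos (p * t)) * getReg (fun _ => (0 : ℝ)) (TProg.runF blockG stk) 4 t
    ∧ getReg (fun _ => (0 : ℝ)) (TProg.runF blockG stk) 0 t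
        = f0 t * (getReg (fun _ => (0 : ℝ)) (TProg.runF blockG stk) 3 t)⁻¹ * p := by
  simp only [blockG, TProg.runF, TOp.evalF, SOp.evalF, getReg_cons_zero, getReg_cons_succ, h0, hc0, hc1, hc2, hc3, hc4, hc5,
    hc6, hXa, hUa, hp, Poly.eval_cons, Poly.eval_nil, Rat.cast_zero, Rat.cast_one, zero_add, add_zero, mul_one, mul_zero]
  refine ⟨?_, ?_, ?_, ?_⟩
  · simp only [cfSolution, UP, U0, U1, U2, U3, U4, U5, U6]; push_cast; ring
  · simp only [CFIterLike.QHalf.Drc, CFIterLike.QHalf.UXc, CFIterLike.QHalf.UYc]; push_cast; ring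
  · trivial
  · trivial

/-! ## §2 Denotations at THE instance (`ψ_N = 9/10`) -/

/-- **THE APPROXIMANT** `m(t)`: the top register of `progA` run on the instance parameters (the in-program chord-Newton ray radius of
the surface `ψ_N = 1/2` in direction `θ = π t`).  OPAQUE: nothing below uses a formula for it. -/
def mA : ℝ → ℝ := progA.toFunP CFIterLike.QHalf.params

/-- The final stack of `progA` on the instance parameters. -/
def stkA : List (ℝ → ℝ) := TProg.runF progA (constStack CFIterLike.QHalf.params)

/-- `progA` has 296 statements. -/
theorem progA_length : CFIterLike.Q90.progA.length = 296 := by decide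

/-- `blockG` has 184 statements. -/
theorem blockG_length : CFIterLike.Q90.blockG.length = 184 := by decide

/-- The top register of `stkA` is `mA`. -/
theorem stkA_top : getReg (fun _ => (0 : ℝ)) CFIterLike.Q90.stkA 0 = mA := rfl

/-- Below `progA`'s 296 pushes sit the constants. -/
theorem stkA_param (i : ℕ) : getReg (fun _ => (0 : ℝ)) CFIterLike.Q90.stkA (296 + i) = getReg (fun _ => (0 : ℝ)) (constStack CFIterLike.QHalf.params) i := by
  rw [stkA, ← progA_length]; exact CFIterLike.QHalf.getReg_runF_add _ progA _ i

/-- **THE REGISTERS OF `progG` AT THE INSTANCE**: residual, radial derivative, the polar `(6.35)` integrand times `π`, and `mA`. -/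
theorem progG_regs (t : ℝ) :
    getReg (fun _ => (0 : ℝ)) (TProg.runF CFIterLike.Q90.progG (constStack CFIterLike.QHalf.params)) CFIterLike.QHalf.idxF t
        = U (Xa + mA t * Real.cos (Real.pi * t)) (mA t * Real.sin (Real.pi * t)) - 1 / 10 * U Xa 0
    ∧ getReg (fun _ => (0 : ℝ)) (TProg.runF progG (constStack CFIterLike.QHalf.params)) CFIterLike.QHalf.idxD t = CFIterLike.QHalf.Drc coeff Xa (mA t) (Real.pi * t)
    ∧ getReg (fun _ => (0 : ℝ)) (TProg.runF progG (constStack CFIterLike.QHalf.params)) 0 t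
        = mA t * ((Xa + mA t * Real.cos (Real.pi * t)) * CFIterLike.QHalf.Drc coeff Xa (mA t) (Real.pi * t))⁻¹ * Real.pi
    ∧ getReg (fun _ => (0 : ℝ)) (TProg.runF progG (constStack CFIterLike.QHalf.params)) CFIterLike.QHalf.idxM t = mA t := by
  have hrun : TProg.runF progG (constStack CFIterLike.QHalf.params) = TProg.runF blockG stkA := by rw [progG, CFIterLike.QHalf.runF_append]; rfl
  rw [hrun]
  have hP : ∀ i, getReg (fun _ => (0 : ℝ)) stkA (296 + i) = getReg (fun _ => (0 : ℝ)) (constStack CFIterLike.QHalf.params) i := stkA_param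
  have h := blockG_regs stkA coeff Xa (U Xa 0) Real.pi mA stkA_top
    (by rw [hP 0]; simp [constStack, CFIterLike.QHalf.params]) (by rw [hP 1]; simp [constStack, CFIterLike.QHalf.params]) (by rw [hP 2]; simp [constStack, CFIterLike.QHalf.params])
    (by rw [hP 3]; simp [constStack, CFIterLike.QHalf.params]) (by rw [hP 4]; simp [constStack, CFIterLike.QHalf.params]) (by rw [hP 5]; simp [constStack, CFIterLike.QHalf.params])
    (by rw [hP 6]; simp [constStack, CFIterLike.QHalf.params]) (by rw [hP 7]; simp [constStack, CFIterLike.QHalf.params]) (by rw [hP 8]; simp [constStack, CFIterLike.QHalf.params])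
    (by rw [hP 9]; simp [constStack, CFIterLike.QHalf.params]) t
  obtain ⟨hF, h4, h3, h0⟩ := h
  refine ⟨?_, ?_, ?_, ?_⟩
  · rw [show CFIterLike.QHalf.idxF = 110 from rfl, hF]; rfl
  · rw [show CFIterLike.QHalf.idxD = 4 from rfl, h4]
  · rw [h0, h3, h4]
  · rw [show CFIterLike.QHalf.idxM = 184 from rfl, show (184 : ℕ) = blockG.length + 0 by rw [blockG_length], CFIterLike.QHalf.getReg_runF_add, stkA_top]

/-! ## §3 Soundness of the per-panel obligation -/

/-- The flux RESIDUAL of the approximant: `U(X_a + m cos θ, m sin θ) − U(X_a, 0)/10` at `θ = π t`. -/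
def resid (t : ℝ) : ℝ := U (Xa + mA t * Real.cos (Real.pi * t)) (mA t * Real.sin (Real.pi * t)) - 1 / 10 * U Xa 0

/-- The radial derivative ALONG THE APPROXIMANT: `D_r(π t, m t)`. -/
def DrA (t : ℝ) : ℝ := CFIterLike.QHalf.Drc coeff Xa (mA t) (Real.pi * t)

/-- From scaled-integer range claims to real bounds on a register (via `bounds_of_tmem`). -/
theorem reg_bounds {j i : ℕ} {W : IPoly} {lo hi : ℤ}
    (hW : TMem CFIterLike.QHalf.tmS CFIterLike.QHalf.hw (fun u => getReg (fun _ => (0 : ℝ)) (TProg.runF CFIterLike.Q90.progG (constStack CFIterLike.QHalf.params)) i ((CFIterLike.QHalf.ctr j : ℝ) + u)) W)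
    (hlo : lo ≤ tlowerI CFIterLike.QHalf.tmS CFIterLike.QHalf.hw W) (hhi : tupperI CFIterLike.QHalf.tmS CFIterLike.QHalf.hw W ≤ hi) {u : ℝ} (hu : |u| ≤ CFIterLike.QHalf.hw) :
    ((lo : ℝ) / CFIterLike.QHalf.tmS) ≤ getReg (fun _ => (0 : ℝ)) (TProg.runF progG (constStack CFIterLike.QHalf.params)) i ((CFIterLike.QHalf.ctr j : ℝ) + u)
      ∧ getReg (fun _ => (0 : ℝ)) (TProg.runF progG (constStack CFIterLike.QHalf.params)) i ((CFIterLike.QHalf.ctr j : ℝ) + u) ≤ ((hi : ℝ) / CFIterLike.QHalf.tmS) := by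
  have hS : ((CFIterLike.QHalf.tmS : ℕ) : ℚ) ≠ 0 := by exact_mod_cast CFIterLike.QHalf.tmS_pos.ne'
  have h := bounds_of_tmem CFIterLike.QHalf.tmS_pos CFIterLike.QHalf.hw_pos.le hW (lo := (lo : ℚ) / CFIterLike.QHalf.tmS) (hi := (hi : ℚ) / CFIterLike.QHalf.tmS)
    (by rw [div_mul_cancel₀ _ hS]; exact_mod_cast hlo) (by rw [div_mul_cancel₀ _ hS]; exact_mod_cast hhi) hu
  push_cast at h
  exact h

/-- **SOUNDNESS OF `PanelCert.ok`.**  If the kernel accepts panel `d.j`, then (i) the lane's integral segment of the polar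
integrand program holds with the claimed bounds, and for every `|u| ≤ h`, at `t = (2j+1)h + u`: (ii) `|resid t| ≤ eta/2⁶⁰`,
(iii) `mA t ∈ [mlo, mhi]/2⁶⁰`, (iv) `DrA t ∈ [dlo, dhi]/2⁶⁰`. -/
theorem sound_of_ok {d : CFIterLike.Q90.PanelCert} (h : d.ok = true) :
    FSegOK (progG.toFunP CFIterLike.QHalf.params) [1] CFIterLike.QHalf.tmS (panelLeft CFIterLike.QHalf.hw d.j) (panelLeft CFIterLike.QHalf.hw (d.j + 1)) d.plo d.phi
    ∧ (∀ u : ℝ, |u| ≤ CFIterLike.QHalf.hw → |resid ((CFIterLike.QHalf.ctr d.j : ℝ) + u)| ≤ (d.eta : ℝ) / CFIterLike.QHalf.tmS)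
    ∧ (∀ u : ℝ, |u| ≤ CFIterLike.QHalf.hw → ((d.mlo : ℝ) / CFIterLike.QHalf.tmS) ≤ mA ((CFIterLike.QHalf.ctr d.j : ℝ) + u) ∧ mA ((CFIterLike.QHalf.ctr d.j : ℝ) + u) ≤ ((d.mhi : ℝ) / CFIterLike.QHalf.tmS))
    ∧ (∀ u : ℝ, |u| ≤ CFIterLike.QHalf.hw → ((d.dlo : ℝ) / CFIterLike.QHalf.tmS) ≤ DrA ((CFIterLike.QHalf.ctr d.j : ℝ) + u) ∧ DrA ((CFIterLike.QHalf.ctr d.j : ℝ) + u) ≤ ((d.dhi : ℝ) / CFIterLike.QHalf.tmS)) := by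
  simp only [PanelCert.ok, Bool.and_eq_true, decide_eq_true_eq] at h
  obtain ⟨⟨⟨⟨⟨⟨⟨⟨hok, hplo⟩, hphi⟩, hFlo⟩, hFhi⟩, hmlo⟩, hmhi⟩, hdlo⟩, hdhi⟩ := h
  unfold panelModels at hok hplo hphi hFlo hFhi hmlo hmhi hdlo hdhi
  have hst := TProg.stackMem_model CFIterLike.QHalf.tmS_pos CFIterLike.QHalf.hw_pos.le (CFIterLike.QHalf.ctr d.j) progG (stackMem_const CFIterLike.QHalf.tmS CFIterLike.QHalf.hw (CFIterLike.QHalf.ctr d.j) CFIterLike.QHalf.boxMem_params) _ hok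
  rw [← CFIterLike.QHalf.pc_eq] at hok hplo hphi
  refine ⟨fsegOK_of_panelCheckT (CFIterLike.QHalf.panelCheckT_of_parts CFIterLike.QHalf.tmS_pos CFIterLike.QHalf.hw_pos hok hplo hphi) CFIterLike.QHalf.boxMem_params, ?_, ?_, ?_⟩
  · intro u hu
    have hb := reg_bounds (hst CFIterLike.QHalf.idxF) hFlo hFhi hu
    rw [(progG_regs _).1] at hb
    rw [resid, abs_le]
    push_cast at hb
    rw [neg_div] at hb
    exact hb
  · intro u hu
    have hb := reg_bounds (hst CFIterLike.QHalf.idxM) hmlo hmhi hu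
    rwa [(progG_regs _).2.2.2] at hb
  · intro u hu
    have hb := reg_bounds (hst CFIterLike.QHalf.idxD) hdlo hdhi hu
    rw [(progG_regs _).2.1] at hb
    exact hb

/-- **The integrand certified by the integral segment IS the polar `(6.35)` integrand along the approximant, times `π`.** -/
theorem progG_toFunP (t : ℝ) :
    CFIterLike.Q90.progG.toFunP CFIterLike.QHalf.params t = mA t * ((Xa + mA t * Real.cos (Real.pi * t)) * DrA t)⁻¹ * Real.pi := by
  unfold TProg.toFunP
  rw [(progG_regs t).2.2.1]
  rfl

/-- The `ψ_N = 9/10` evaluation block has the same length as the `ψ_N = 1/2` one (they differ in one constant only). -/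
theorem blockG_length_eq_half : CFIterLike.Q90.blockG.length = CFIterLike.QHalf.blockG.length := by
  rw [blockG_length, CFIterLike.QHalf.blockG_length]

end Summit.Ventures.FusionMHD.Models.CFIterLike.Q90

end
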